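import Summits.HodgeConjecture.HodgeConjecture.Theorems.Ring2AbelianAllAndreInvariantHomNum
import Summits.HodgeConjecture.HodgeConjecture.Theorems.Ring2AbelianAllAndreFibreClassDivisionNodes
import Summits.HodgeConjecture.HodgeConjecture.Theorems.Ring2AbelianAllAndreFibreGysinRange
import Summits.HodgeConjecture.HodgeConjecture.Theorems.Ring2AbelianAllAndrePrimitiveLift
import HarnessLib

/-!
# Ring 2 · sub-cell AbelianAll (ALL ABELIAN VARIETIES), André axis, part XXX-b — THE UNCONDITIONAL IMPLICATION WEB
# `Div ⟹ (Num_t) ⟹ (Num_t)^{inv} ⟺ (L)` AND `Div ⟹ (Num₂)`; IN THE MIDDLE DEGREE `Div ⟺ (Num₂)`; the lift moves UP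
# (`(L)_t(p) ⟹ (L)_t(d-p)` for `2p ≤ d`); the CM nodes: `Div^CM ⟹ Num^CM` and `(L) ⟺ Num^{CM,inv}` WITHOUT `HC_CM`

HONEST FRAMING (page 1, verbatim): **research route, not a corollary; conditional on HC_CM plus one named
minimal statement.** Cell line: research route conditional on HC_CM; not a corollary; Q11.4-sentence-2
already refuted in dim ≥ 3. Nothing in this file proves a case of the Hodge conjecture for an abelian variety;
`HC_CM` (`Theses.RankFourFaces.CMAbelianHodge`) does not occur in this file; item `Theses.RankFourFaces.CMToAbelian`
(stmt-HodgeConjecture-16267) OPEN and not closed here. Seat `pub-hodge-ring2-ab-andre-2`, gen 22; brief (ii) "record each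
version and prove the implications between them", (iii) "smallest open instance". Sequel of part XXX-a
(`Ring2AbelianAllAndreInvariantHomNum`: hom ≡ num on the invariant algebraic classes of a fibre, `(L)_t(p) ⟺ (Num_t)^{inv}(p,q)`).

## Setting and the four hypotheses at a point `t` of a compact pencil `f : 𝒳 ⟶ S` of abelian `d`-folds (`p + q = d`)

* (L)_t(p): `(j_t^*)⁻¹ N^p(X_t) ≤ N^p(𝒳) + ker j_t^*` (the lift; node `CMFibreAlgebraicLift` at CM points);
* (Num_t)(p,q): `b ∈ N^q(X_t)`, `a ∪ j_{t*} b = 0` for all `a ∈ N^p(𝒳)` ⟹ `j_{t*} b = 0` (node `CMPointedPencilNumerical`);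
* (Num_t)^{inv}(p,q): the same for INVARIANT `b ∈ N^q(X_t) ∩ Im j_t^*` (part XXX-a);
* Div[t,p]: `L_t⁻¹ N^{p+1}(𝒳) ≤ N^p(𝒳) + ker j_t^*`, `L_t = j_{t*} j_t^*` (part XXIX-c's display-only bracket, restated here);
* (Num₂)(t,p): `L_t x ∈ N^{p+1}(𝒳)` cup-orthogonal to `N^q(𝒳)` ⟹ `L_t x = 0` (part XXIX-a).

## What is proved (theorems only; no definition, no named fact, no sorry; the bracket is `local notation3`)

§1 **`comap_le_sup_compl_of_le`** — `(L)_t(p) ⟹ (L)_t(d-p)` for `2p ≤ d` (hard Lefschetz moves the lift UP: `A(X_t, κ)` on the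
abelian fibre (Lieberman), `Im j_t^*` in degree `2(d-p)` is `L_κ^{d-2p} Im j_t^*` (part XIV-g), `K` algebraic on `𝒳` (part XXI-a)).
§2 **`numerical_of_fibreClassDivisionAt_of_comap_le_sup`** — `Div[t,q] ∧ (L)_t(p) ⟹ (Num_t)(p,q)` for ALL algebraic `b` on the
fibre (decompose `b = j_t^* x + k`, `j_{t*} k = 0`, part XXVII-b; `L_t x = j_{t*} b` is algebraic, so `Div` replaces `x` by an algebraic
`x'`; then part XXX-a); **`numerical_of_fibreClassDivisionAt_of_le`** (`2q ≤ d`: `Div[t,q]` alone); `numerical_of_forall_fibreClassDivisionAt`.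
§3 **`numerical₂_of_fibreClassDivisionAt_of_comap_le_sup`** — `Div[t,p] ∧ (L)_t(q) ⟹ (Num₂)(t,p)`;
**`numerical₂_of_fibreClassDivisionAt_of_le`** (`2p ≤ d`: `Div[t,p]` alone); **`fibreClassDivisionAt_iff_numerical₂_middle`** —
IN THE MIDDLE DEGREE `d = 2p`, `Div[t,p] ⟺ (Num₂)(t,p)`: "division by the fibre class" IS "hom ≡ num on the `(2p+1)`-fold `𝒳` for the
algebraic classes `x ∪ [X_t]`, tested against `N^p(𝒳)`" (so part XXIX-c's W₆ input and its `Div[t₀,3]` input coincide);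
**`fibreClassDivisionAt_iff_comap_le_sup_and_numerical₂_of_le`** (`2p ≤ d`: `Div[t,p] ⟺ (L)_t(p) ∧ (Num₂)(t,p)`);
`fibreClassDivisionAt_two_iff_numerical₂_relDim_four` (`d = 4`).
§4 CM nodes, NO `HC_CM`: **`cmPointedPencilNumerical_of_fibreClassDivisionCM`** (`Div^CM ⟹ Num^CM`; parts XVIII-c/XXIX-e had the
comparison only under `HC_CM`), **`cmFibreAlgebraicLift_iff_numericalInvCM`** (`(L) ⟺ Num^{CM,inv}`; with the tree's
`cmFibreAlgebraicLift_of_cmPointedPencilNumerical`: `Num^CM ⟹ (L) ⟺ Num^{CM,inv}`).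

So, unconditionally and at every point: `Div[t,·] (all degrees) ⟹ (Num_t) (all bidegrees) ⟹ (Num_t)^{inv} ⟺ (L)`, and in each
degree `2p ≤ d`: `Div[t,p] ⟺ (L)_t(p) ∧ (Num₂)(t,p)`. At a fibre satisfying the Hodge conjecture all five coincide (parts XVIII-c,
XXIX-e). Nothing here is minimal; no node is born.

References: Lieberman1968 (main theorem); Kleiman1968AlgebraicCycles (§3 Prop. 3.8, Cor. 3.9); Grothendieck1968 (§3 p. 196);
VoisinHodgeI2002 (§6.2.3 Thm. 6.25, §6.3.2 Thm. 6.32, §7.1.2); VoisinHodgeII2003 (§4.3.1 Thm. 4.18, §9.2.4 Prop. 9.20);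
DeligneHodgeII1971 (Thm. 4.1.1); Milne2020HodgeClassesAV (Prop. 1 p. 7); Andre1996Motifs (§5.1, Lemme 6.3.1, Remarque 2 p. 33);
Abdulali1994FamiliesAV (Conj. 5.3 p. 1130); FultonYoungTableaux1997 (App. B §B.1 (6)); HatcherAT2002 (§3.2 Thm. 3.11, §3.3 Prop. 3.38).
-/

noncomputable section

set_option linter.dupNamespace false

namespace Summit.HodgeConjecture.HodgeConjecture.Ring2.AbelianAll

open CategoryTheory AlgebraicGeometry
open Literature.AlgebraicGeometry Literature.AlgebraicGeometry.Motives
open Literature.AlgebraicGeometry.HodgeTheory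
open Literature.AlgebraicTopology.SingularHomology (singularCohomology cupProduct cupProduct_gradedComm_holds)
open Literature.Geometry.Kaehler (lefschetzOperator HasHardLefschetzProperty)
open Literature.AlgebraicGeometry.Deligne1982 (cmLocus)
open Summit.HodgeConjecture.HodgeConjecture.Theses

variable {𝒳 S : SchemeOver ℂ} {d : ℕ} {f : 𝒳 ⟶ S}

/-- (Div) `Div[hf, t, p]` — division by the fibre class at `t` in degree `2p` (part XXIX-c's display-only bracket, restated verbatim):
`L_t⁻¹ N^{p+1}(𝒳) ≤ N^p(𝒳) + ker j_t^*`, `L_t = j_{t*} j_t^*`. Census-invisible; a HYPOTHESIS wherever it occurs.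
[cite: Grothendieck1968, §3 p. 196 (A(X, L))] [cite: Abdulali1994FamiliesAV, Conjecture 5.3 (p. 1130)] -/
local notation3 "Div[" hf ", " t ", " p "]" =>
  Submodule.comap ((fiberGysin hf t p) ∘ₗ (complexBetti.map (fiberι f t) (2 * p)).hom) (algebraicClasses 𝒳 (p + 1)) ≤
    algebraicClasses 𝒳 p ⊔ LinearMap.ker (complexBetti.map (fiberι f t) (2 * p)).hom

/-! ## §1 Hard Lefschetz moves the lift up: `(L)_t(p) ⟹ (L)_t(d - p)` for `2p ≤ d` -/

/-- **`(L)_t(p) ⟹ (L)_t(p + r)` for `2p + r = d`.** Let `K ∈ N¹(𝒳)` polarise every fibre (part XXI-a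
`exists_algebraic_globalPolarization`), `κ = j_t^* K`. An invariant algebraic class `y` of degree `2(p+r)` on `X_t` is `L_κʳ c`
with `c ∈ N^p(X_t)` (`A(X_t, κ)`, Lieberman) and `L_κʳ c'` with `c'` invariant (`Im j_t^* = L_κʳ Im j_t^*` in these degrees, part XIV-g);
`L_κʳ` is injective on `H^{2p}` (hard Lefschetz), so `c = c'` is invariant algebraic, `= j_t^* a` with `a ∈ N^p(𝒳)` by (L)_t(p), and
`y = j_t^*(L_Kʳ a)` with `L_Kʳ a ∈ N^{p+r}(𝒳)`. [cite: VoisinHodgeI2002, §6.2.3 Thm. 6.25] [cite: Lieberman1968, main theorem]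
[cite: Kleiman1968AlgebraicCycles, §3] [cite: Milne2020HodgeClassesAV, Prop. 1 (p. 7)] -/
theorem comap_le_sup_compl_of_le (hf : IsCompactAbelianPencil f d) (t : ComplexPoints S) {p r : ℕ} (hpr : 2 * p + r = d)
    (hL : (algebraicClasses (fiberOver f t) p).comap (complexBetti.map (fiberι f t) (2 * p)).hom ≤
      algebraicClasses 𝒳 p ⊔ LinearMap.ker (complexBetti.map (fiberι f t) (2 * p)).hom) :
    (algebraicClasses (fiberOver f t) (p + r)).comap (complexBetti.map (fiberι f t) (2 * (p + r))).hom ≤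
      algebraicClasses 𝒳 (p + r) ⊔ LinearMap.ker (complexBetti.map (fiberι f t) (2 * (p + r))).hom := by
  have h𝒳 := hf.isSmoothProjective_total
  obtain ⟨K, hK1, -, hKpol⟩ := exists_algebraic_globalPolarization hf
  have hKL : ∀ s : ComplexPoints S, HasHardLefschetzProperty (complexBetti.map (fiberι f s) 2 K) d :=
    fun s ↦ (hKpol s).hasHardLefschetz
  have hm : 2 * p + 2 * r = 2 * (p + r) := by ring
  set Lt := lefschetzPowTo (complexBetti.map (fiberι f t) 2 K) r (2 * p) (2 * (p + r)) hm with hLt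
  have hinj : Function.Injective Lt := (bijective_lefschetzPowTo_of_hasHardLefschetz _ (hKL t) hpr _ hm).1
  intro W hW
  have hW' : complexBetti.map (fiberι f t) (2 * (p + r)) W ∈ algebraicClasses (fiberOver f t) (p + r) := hW
  -- `y = Lᵣ c` with `c` algebraic (conjecture A on the abelian fibre)
  obtain ⟨c, hc, hcy⟩ := exists_lefschetzPowTo_eq_of_standardConjectureA (standardConjectureA_fiberOver hf t (hKpol t))
    hpr hm hW'
  -- `y = Lᵣ c'` with `c'` invariant
  have hyI : complexBetti.map (fiberι f t) (2 * (p + r)) W ∈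
      (LinearMap.range (complexBetti.map (fiberι f t) (2 * p)).hom).map Lt := by
    rw [← range_map_fiberι_eq_map_lefschetzPowTo hf hKL hpr hm t]
    exact ⟨W, rfl⟩
  obtain ⟨c', ⟨W', hW'c⟩, hc'y⟩ := hyI
  have hcc' : c = c' := hinj (by rw [← hLt] at hcy; rw [hcy, hc'y])
  -- `c = j_t^* W'` is invariant algebraic, so `W' ∈ N^p(𝒳) + ker` by (L)_t(p)
  have hW'c' : complexBetti.map (fiberι f t) (2 * p) W' = c := by rw [hcc']; exact hW'c
  have hW'mem : W' ∈ (algebraicClasses (fiberOver f t) p).comap (complexBetti.map (fiberι f t) (2 * p)).hom := by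
    rw [Submodule.mem_comap]
    change complexBetti.map (fiberι f t) (2 * p) W' ∈ _
    rw [hW'c']
    exact hc
  obtain ⟨a, ha, k, hk, hak⟩ := Submodule.mem_sup.1 (hL hW'mem)
  rw [LinearMap.mem_ker] at hk
  have hca : c = complexBetti.map (fiberι f t) (2 * p) a := by
    rw [← hW'c', ← hak, map_add]
    rw [show complexBetti.map (fiberι f t) (2 * p) k = 0 from hk, add_zero]
  -- `W - L_Kʳ a ∈ ker j_t^*`
  have hLa : lefschetzPowTo K r (2 * p) (2 * (p + r)) hm a ∈ algebraicClasses 𝒳 (p + r) :=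
    lefschetzPowTo_mem_algebraicClasses h𝒳 hK1 ha r (p + r) rfl hm
  rw [show W = lefschetzPowTo K r (2 * p) (2 * (p + r)) hm a + (W - lefschetzPowTo K r (2 * p) (2 * (p + r)) hm a) by abel]
  refine Submodule.add_mem_sup hLa ?_
  rw [LinearMap.mem_ker, map_sub, sub_eq_zero]
  change complexBetti.map (fiberι f t) (2 * (p + r)) W =
    complexBetti.map (fiberι f t) (2 * (p + r)) (lefschetzPowTo K r (2 * p) (2 * (p + r)) hm a)
  rw [map_fiberι_lefschetzPowTo t K r (2 * p) (2 * (p + r)) hm a, ← hca, ← hLt, hcy]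

/-- **`(L)_t(p) ⟹ (L)_t(q)` for `p + q = d`, `p ≤ q`** (§1 with `r = q - p`). [cite: VoisinHodgeI2002, §6.2.3 Thm. 6.25]
[cite: Lieberman1968, main theorem] -/
theorem comap_le_sup_compl_of_le' (hf : IsCompactAbelianPencil f d) (t : ComplexPoints S) {p q : ℕ} (hpq : p + q = d)
    (hle : p ≤ q)
    (hL : (algebraicClasses (fiberOver f t) p).comap (complexBetti.map (fiberι f t) (2 * p)).hom ≤
      algebraicClasses 𝒳 p ⊔ LinearMap.ker (complexBetti.map (fiberι f t) (2 * p)).hom) :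
    (algebraicClasses (fiberOver f t) q).comap (complexBetti.map (fiberι f t) (2 * q)).hom ≤
      algebraicClasses 𝒳 q ⊔ LinearMap.ker (complexBetti.map (fiberι f t) (2 * q)).hom := by
  obtain ⟨r, rfl⟩ : ∃ r, q = p + r := ⟨q - p, by omega⟩
  exact comap_le_sup_compl_of_le hf t (by omega) hL

/-! ## §2 `Div[t, q] ∧ (L)_t(p) ⟹ (Num_t)(p,q)` for ALL algebraic classes of the fibre -/

/-- **`Div[t,q] ∧ (L)_t(p) ⟹ (Num_t)(p,q)`** (`p + q = d`), for every algebraic `b ∈ N^q(X_t)`, invariant or not. Decompose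
`b = j_t^* x + k` with `j_{t*} k = 0` (`H(X_t) = Im j_t^* ⊕ ker j_{t*}`, part XXVII-b); `L_t x = j_{t*} b ∈ N^{q+1}(𝒳)`, so `Div[t,q]` gives
`j_t^* x = j_t^* x'` with `x' ∈ N^q(𝒳)`; now `j_t^* x'` is invariant algebraic and `a ∪ j_{t*} j_t^* x' = a ∪ j_{t*} b = 0` for all
`a ∈ N^p(𝒳)`, so `j_{t*} b = j_{t*} j_t^* x' = 0` by part XXX-a ((L)_t(p) ⟹ (Num_t)^{inv}(p,q)). [cite: Kleiman1968AlgebraicCycles, §3 (D(X))]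
[cite: DeligneHodgeII1971, Thm. 4.1.1] [cite: Lieberman1968, main theorem] -/
theorem numerical_of_fibreClassDivisionAt_of_comap_le_sup (hf : IsCompactAbelianPencil f d) (t : ComplexPoints S)
    {p q : ℕ} (hpq : p + q = d) (hDiv : Div[hf, t, q])
    (hL : (algebraicClasses (fiberOver f t) p).comap (complexBetti.map (fiberι f t) (2 * p)).hom ≤
      algebraicClasses 𝒳 p ⊔ LinearMap.ker (complexBetti.map (fiberι f t) (2 * p)).hom) :
    ∀ b ∈ algebraicClasses (fiberOver f t) q,
      (∀ a ∈ algebraicClasses 𝒳 p,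
        cupProduct (show 2 * p + 2 * (q + 1) = 2 * (d + 1) by omega) a (fiberGysin hf t q b) = 0) →
        fiberGysin hf t q b = 0 := by
  intro b hb hab
  -- `b = j_t^* x + k`, `j_{t*} k = 0`
  have hc : IsCompl (LinearMap.range (complexBetti.map (fiberι f t) (2 * q)).hom) (LinearMap.ker (fiberGysin hf t q)) :=
    isCompl_range_map_fiberι_ker_complexGysin hf.isSmoothProjective_base hf.isSmoothProjectiveFamily
      hf.isSmoothProjective_total (show 2 * q + 2 * (d + 1) = 2 * (q + 1) + 2 * d by ring) t
  have hbmem : b ∈ LinearMap.range (complexBetti.map (fiberι f t) (2 * q)).hom ⊔ LinearMap.ker (fiberGysin hf t q) := by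
    rw [hc.sup_eq_top]
    exact Submodule.mem_top
  obtain ⟨y, ⟨x, hxy⟩, k, hk, hyk⟩ := Submodule.mem_sup.1 hbmem
  rw [LinearMap.mem_ker] at hk
  have hxy' : complexBetti.map (fiberι f t) (2 * q) x = y := hxy
  have hjb : fiberGysin hf t q b = fiberGysin hf t q (complexBetti.map (fiberι f t) (2 * q) x) := by
    rw [← hyk, map_add, hk, add_zero, hxy']
  -- `L_t x = j_{t*} b` is algebraic; divide by the fibre class
  have hLx : x ∈ Submodule.comap ((fiberGysin hf t q) ∘ₗ (complexBetti.map (fiberι f t) (2 * q)).hom)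
      (algebraicClasses 𝒳 (q + 1)) := by
    rw [Submodule.mem_comap, LinearMap.comp_apply]
    change fiberGysin hf t q (complexBetti.map (fiberι f t) (2 * q) x) ∈ _
    rw [← hjb]
    exact fiberGysin_mem_algebraicClasses hf t hb
  obtain ⟨x', hx', k', hk', hxk⟩ := Submodule.mem_sup.1 (hDiv hLx)
  rw [LinearMap.mem_ker] at hk'
  have hjx : complexBetti.map (fiberι f t) (2 * q) x = complexBetti.map (fiberι f t) (2 * q) x' := by
    rw [← hxk, map_add]
    rw [show complexBetti.map (fiberι f t) (2 * q) k' = 0 from hk', add_zero]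
  -- part XXX-a on the invariant algebraic class `j_t^* x'`
  rw [hjb, hjx]
  refine numericalInv_of_comap_le_sup hf t hpq hL _
    (map_algebraicClasses_le_inf_range hf t q (Submodule.mem_map_of_mem hx')) fun a ha ↦ ?_
  rw [← hjx, ← hjb]
  exact hab a ha

/-- **`2q ≤ d`: `Div[t,q]` ALONE ⟹ (Num_t)(d-q, q)`** — `Div[t,q] ⟹ (L)_t(q)` (part XXIX-c) `⟹ (L)_t(d-q)` (§1). In particular in the
middle degree `d = 2q` and below it, division by the fibre class gives part XVIII's full numerical hypothesis, unconditionally.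
[cite: Kleiman1968AlgebraicCycles, §3 (D(X))] [cite: Lieberman1968, main theorem] -/
theorem numerical_of_fibreClassDivisionAt_of_le (hf : IsCompactAbelianPencil f d) (t : ComplexPoints S) {p q : ℕ}
    (hpq : p + q = d) (hle : q ≤ p) (hDiv : Div[hf, t, q]) :
    ∀ b ∈ algebraicClasses (fiberOver f t) q,
      (∀ a ∈ algebraicClasses 𝒳 p,
        cupProduct (show 2 * p + 2 * (q + 1) = 2 * (d + 1) by omega) a (fiberGysin hf t q b) = 0) →
        fiberGysin hf t q b = 0 :=
  numerical_of_fibreClassDivisionAt_of_comap_le_sup hf t hpq hDiv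
    (comap_le_sup_compl_of_le' hf t (show q + p = d by omega) hle (comap_le_sup_of_fibreClassDivisionAt hf hDiv))

/-- **Division in ALL degrees at `t` ⟹ (Num_t) in ALL bidegrees at `t`.** [cite: Kleiman1968AlgebraicCycles, §3 (D(X))] -/
theorem numerical_of_forall_fibreClassDivisionAt (hf : IsCompactAbelianPencil f d) (t : ComplexPoints S)
    (hDiv : ∀ p : ℕ, Div[hf, t, p]) {p q : ℕ} (hpq : p + q = d) :
    ∀ b ∈ algebraicClasses (fiberOver f t) q,
      (∀ a ∈ algebraicClasses 𝒳 p,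
        cupProduct (show 2 * p + 2 * (q + 1) = 2 * (d + 1) by omega) a (fiberGysin hf t q b) = 0) →
        fiberGysin hf t q b = 0 :=
  numerical_of_fibreClassDivisionAt_of_comap_le_sup hf t hpq (hDiv q) (comap_le_sup_of_fibreClassDivisionAt hf (hDiv p))

/-! ## §3 `Div[t, p] ∧ (L)_t(q) ⟹ (Num₂)(t, p)`; in the middle degree `Div ⟺ (Num₂)` -/

/-- **`Div[t,p] ∧ (L)_t(q) ⟹ (Num₂)(t,p)`** (`p + q = d`): an ALGEBRAIC class `L_t x ∈ N^{p+1}(𝒳)` cup-orthogonal to `N^q(𝒳)` vanishes.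
By `Div[t,p]`, `j_t^* x = j_t^* x'` with `x'` algebraic; `j_t^* x'` is an invariant algebraic class orthogonal (transpose) to
`j_t^* N^q(𝒳)`, which is ALL of `N^q(X_t) ∩ Im j_t^*` by (L)_t(q); so `j_t^* x' = 0` by part XXX-a §2 and `L_t x = j_{t*} j_t^* x' = 0`. No
Hodge hypothesis (part XXIX-e's `numerical₂_of_comap_le_sup_of_hodge` needed `HC^q(X_t)`). [cite: Kleiman1968AlgebraicCycles, §3 (D(X))]
[cite: Lieberman1968, main theorem] [cite: FultonYoungTableaux1997, Appendix B §B.1 (6)] -/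
theorem numerical₂_of_fibreClassDivisionAt_of_comap_le_sup (hf : IsCompactAbelianPencil f d) (t : ComplexPoints S)
    {p q : ℕ} (hpq : p + q = d) (hDiv : Div[hf, t, p])
    (hLq : (algebraicClasses (fiberOver f t) q).comap (complexBetti.map (fiberι f t) (2 * q)).hom ≤
      algebraicClasses 𝒳 q ⊔ LinearMap.ker (complexBetti.map (fiberι f t) (2 * q)).hom) :
    ∀ x : complexBetti 𝒳 (2 * p),
      fiberGysin hf t p (complexBetti.map (fiberι f t) (2 * p) x) ∈ algebraicClasses 𝒳 (p + 1) →
      (∀ w ∈ algebraicClasses 𝒳 q, cupProduct (show 2 * (p + 1) + 2 * q = 2 * (d + 1) by omega)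
          (fiberGysin hf t p (complexBetti.map (fiberι f t) (2 * p) x)) w = 0) →
        fiberGysin hf t p (complexBetti.map (fiberι f t) (2 * p) x) = 0 := by
  intro x hx horth
  obtain ⟨x', hx', k', hk', hxk⟩ := Submodule.mem_sup.1 (hDiv hx)
  rw [LinearMap.mem_ker] at hk'
  have hjx : complexBetti.map (fiberι f t) (2 * p) x = complexBetti.map (fiberι f t) (2 * p) x' := by
    rw [← hxk, map_add]
    rw [show complexBetti.map (fiberι f t) (2 * p) k' = 0 from hk', add_zero]
  have hy0 : complexBetti.map (fiberι f t) (2 * p) x' = 0 := by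
    refine eq_zero_of_forall_cupProduct_eq_zero_of_invariant hf t hpq
      (map_algebraicClasses_le_inf_range hf t p (Submodule.mem_map_of_mem hx')) fun b hb ↦ ?_
    rw [inf_range_eq_map_of_comap_le_sup hf t q hLq] at hb
    obtain ⟨w, hw, rfl⟩ := hb
    change cupProduct _ (complexBetti.map (fiberι f t) (2 * p) x') (complexBetti.map (fiberι f t) (2 * q) w) = 0
    rw [cupProduct_gradedComm_holds ℂ (ComplexPoints (fiberOver f t)) (show 2 * p + 2 * q = 2 * d by omega)
      (show 2 * q + 2 * p = 2 * d by omega) _ _,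
      (cupProduct_map_fiberι_eq_zero_iff hf t (show q + p = d by omega) w _).2 ?_, smul_zero]
    rw [cupProduct_gradedComm_holds ℂ (ComplexPoints 𝒳) (show 2 * q + 2 * (p + 1) = 2 * (d + 1) by omega)
      (show 2 * (p + 1) + 2 * q = 2 * (d + 1) by omega) w _, ← hjx, horth w hw, smul_zero]
  rw [hjx, hy0, map_zero]

/-- **`2p ≤ d`: `Div[t,p]` ALONE ⟹ (Num₂)(t,p)`** (`Div[t,p] ⟹ (L)_t(p) ⟹ (L)_t(d-p)`, part XXIX-c and §1).
[cite: Kleiman1968AlgebraicCycles, §3 (D(X))] [cite: Lieberman1968, main theorem] -/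
theorem numerical₂_of_fibreClassDivisionAt_of_le (hf : IsCompactAbelianPencil f d) (t : ComplexPoints S) {p q : ℕ}
    (hpq : p + q = d) (hle : p ≤ q) (hDiv : Div[hf, t, p]) :
    ∀ x : complexBetti 𝒳 (2 * p),
      fiberGysin hf t p (complexBetti.map (fiberι f t) (2 * p) x) ∈ algebraicClasses 𝒳 (p + 1) →
      (∀ w ∈ algebraicClasses 𝒳 q, cupProduct (show 2 * (p + 1) + 2 * q = 2 * (d + 1) by omega)
          (fiberGysin hf t p (complexBetti.map (fiberι f t) (2 * p) x)) w = 0) →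
        fiberGysin hf t p (complexBetti.map (fiberι f t) (2 * p) x) = 0 :=
  numerical₂_of_fibreClassDivisionAt_of_comap_le_sup hf t hpq hDiv
    (comap_le_sup_compl_of_le' hf t hpq hle (comap_le_sup_of_fibreClassDivisionAt hf hDiv))

/-- **THE MIDDLE DEGREE `d = 2p`: `Div[t,p] ⟺ (Num₂)(t,p)`.** Division by the fibre class in the middle degree of a compact pencil of
abelian `2p`-folds IS the statement "an algebraic class `x ∪ [X_t] ∈ N^{p+1}(𝒳)` of the `(2p+1)`-fold `𝒳` which is numerically trivial
against `N^p(𝒳)` is homologically trivial" — conjecture `D(𝒳)` for fibre-class-divisible classes, and nothing else. (`⟸` is part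
XXIX-c's `fibreClassDivisionAt_middle_of_numerical`; `⟹` is new.) Instances: `(d,p) = (4,2)` (abelian fourfold pencils — the first open
case) and `(6,3)` (part XXIX-c's single W₆ input per sevenfold, which therefore EQUALS `Div[t₀,3]`). [cite: Kleiman1968AlgebraicCycles, §3 (D(X))]
[cite: Lieberman1968, main theorem] [cite: Abdulali1994FamiliesAV, Conjecture 5.3 (p. 1130)] -/
theorem fibreClassDivisionAt_iff_numerical₂_middle (hf : IsCompactAbelianPencil f d) (t : ComplexPoints S) {p : ℕ}
    (hp : p + p = d) :
    Div[hf, t, p] ↔ ∀ x : complexBetti 𝒳 (2 * p),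
      fiberGysin hf t p (complexBetti.map (fiberι f t) (2 * p) x) ∈ algebraicClasses 𝒳 (p + 1) →
      (∀ w ∈ algebraicClasses 𝒳 p, cupProduct (show 2 * (p + 1) + 2 * p = 2 * (d + 1) by omega)
          (fiberGysin hf t p (complexBetti.map (fiberι f t) (2 * p) x)) w = 0) →
        fiberGysin hf t p (complexBetti.map (fiberι f t) (2 * p) x) = 0 :=
  ⟨fun h ↦ numerical₂_of_fibreClassDivisionAt_of_le hf t hp le_rfl h, fibreClassDivisionAt_middle_of_numerical hf t hp⟩

/-- **`2p ≤ d`: `Div[t,p] ⟺ (L)_t(p) ∧ (Num₂)(t,p)`** — division by the fibre class is EXACTLY the lift plus hom ≡ num for the algebraic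
fibre-class multiples (`⟸`: (L)_t(p) gives (Num₁)(p,q), part XXX-a, and (Num₁) ∧ (Num₂) ⟹ Div, part XXIX-c; `⟹`: part XXIX-c and §3).
[cite: Kleiman1968AlgebraicCycles, §3 (D(X))] [cite: Milne2020HodgeClassesAV, Prop. 1 (p. 7)] -/
theorem fibreClassDivisionAt_iff_comap_le_sup_and_numerical₂_of_le (hf : IsCompactAbelianPencil f d) (t : ComplexPoints S)
    {p q : ℕ} (hpq : p + q = d) (hle : p ≤ q) :
    Div[hf, t, p] ↔
      ((algebraicClasses (fiberOver f t) p).comap (complexBetti.map (fiberι f t) (2 * p)).hom ≤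
          algebraicClasses 𝒳 p ⊔ LinearMap.ker (complexBetti.map (fiberι f t) (2 * p)).hom) ∧
        ∀ x : complexBetti 𝒳 (2 * p),
          fiberGysin hf t p (complexBetti.map (fiberι f t) (2 * p) x) ∈ algebraicClasses 𝒳 (p + 1) →
          (∀ w ∈ algebraicClasses 𝒳 q, cupProduct (show 2 * (p + 1) + 2 * q = 2 * (d + 1) by omega)
              (fiberGysin hf t p (complexBetti.map (fiberι f t) (2 * p) x)) w = 0) →
            fiberGysin hf t p (complexBetti.map (fiberι f t) (2 * p) x) = 0 :=
  ⟨fun h ↦ ⟨comap_le_sup_of_fibreClassDivisionAt hf h, numerical₂_of_fibreClassDivisionAt_of_le hf t hpq hle h⟩,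
    fun h ↦ fibreClassDivisionAt_of_numerical hf t hpq (numerical₁_of_comap_le_sup hf t hpq h.1) h.2⟩

/-- **`d = 4`, the first open case, in its sharpest form: `Div[t,2] ⟺ (Num₂)(t,2)`** — on the FIVEFOLD total space of a compact pencil
of abelian fourfolds, "an algebraic 2-cycle class of the form `x ∪ [X_t]` numerically trivial against the algebraic threefold classes
`N²(𝒳)` is zero". (In every other degree `Div[t,p]`, `p ≠ 2`, holds unconditionally, part XXIX-d.) [cite: Kleiman1968AlgebraicCycles, §3 (D(X))]
[cite: Lieberman1968, Thm. 1] -/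
theorem fibreClassDivisionAt_two_iff_numerical₂_relDim_four (hf : IsCompactAbelianPencil f 4) (t : ComplexPoints S) :
    Div[hf, t, 2] ↔ ∀ x : complexBetti 𝒳 (2 * 2),
      fiberGysin hf t 2 (complexBetti.map (fiberι f t) (2 * 2) x) ∈ algebraicClasses 𝒳 (2 + 1) →
      (∀ w ∈ algebraicClasses 𝒳 2, cupProduct (show 2 * (2 + 1) + 2 * 2 = 2 * (4 + 1) by rfl)
          (fiberGysin hf t 2 (complexBetti.map (fiberι f t) (2 * 2) x)) w = 0) →
        fiberGysin hf t 2 (complexBetti.map (fiberι f t) (2 * 2) x) = 0 :=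
  fibreClassDivisionAt_iff_numerical₂_middle hf t (show 2 + 2 = 4 by rfl)

/-! ## §4 The CM nodes without `HC_CM`: `Div^CM ⟹ Num^CM`, `(L) ⟺ Num^{CM,inv}` -/

/-- **`Div^CM ⟹ Num^CM` WITHOUT `HC_CM`**: division by the fibre class in every degree at every CM point of every compact abelian
pencil gives part XVIII-c's node `CMPointedPencilNumerical` (conjecture `D` for the cycles of the total space supported on a CM
fibre) — §2 (`Div[t,q] ∧ (L)_t(p)`, the latter from `Div[t,p]`). Parts XVIII-c / XXIX-e compared these hypotheses only under `HC_CM`.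
[cite: Kleiman1968AlgebraicCycles, §3 (D(X))] [cite: Andre1996Motifs, §6.3 Remarque 2 (p. 33)] -/
theorem cmPointedPencilNumerical_of_fibreClassDivisionCM
    (hDiv : ∀ ⦃d : ℕ⦄ ⦃𝒳 S : SchemeOver ℂ⦄ (f : 𝒳 ⟶ S) (hf : IsCompactAbelianPencil f d) (p : ℕ), ∀ t ∈ cmLocus f d,
      Submodule.comap ((fiberGysin hf t p) ∘ₗ (complexBetti.map (fiberι f t) (2 * p)).hom) (algebraicClasses 𝒳 (p + 1)) ≤
        algebraicClasses 𝒳 p ⊔ LinearMap.ker (complexBetti.map (fiberι f t) (2 * p)).hom) :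
    CMPointedPencilNumerical := by
  intro d 𝒳 S f hf t ht p q hpq
  exact numerical_of_forall_fibreClassDivisionAt hf t (fun p' ↦ hDiv f hf p' t ht) hpq

/-- **`(L) ⟺ Num^{CM,inv}` WITHOUT `HC_CM`**: the lift node `CMFibreAlgebraicLift` is EQUIVALENT to the invariant part of `Num^CM` —
"at every CM point `t` of every compact abelian pencil, for `p + q = d`, an invariant algebraic `b ∈ N^q(X_t) ∩ Im j_t^*` with
`a ∪ j_{t*} b = 0` for all `a ∈ N^p(𝒳)` has `j_{t*} b = 0`" (part XXX-a pointwise; part XVII-b's lattice form of the node). So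
`Num^CM ⟹ (L) ⟺ Num^{CM,inv}` unconditionally, and under `HC_CM` all three coincide (part XVIII-c).
[cite: Kleiman1968AlgebraicCycles, §3 (D(X))] [cite: Milne2020HodgeClassesAV, Prop. 1 (p. 7)] [cite: Andre1996Motifs, §5.1 and §6.3] -/
theorem cmFibreAlgebraicLift_iff_numericalInvCM :
    CMFibreAlgebraicLift ↔ ∀ ⦃d : ℕ⦄ ⦃𝒳 S : SchemeOver ℂ⦄ (f : 𝒳 ⟶ S) (hf : IsCompactAbelianPencil f d) (t : ComplexPoints S),
      t ∈ cmLocus f d → ∀ (p q : ℕ) (hpq : p + q = d),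
        ∀ b ∈ algebraicClasses (fiberOver f t) q ⊓ LinearMap.range (complexBetti.map (fiberι f t) (2 * q)).hom,
          (∀ a ∈ algebraicClasses 𝒳 p,
            cupProduct (show 2 * p + 2 * (q + 1) = 2 * (d + 1) by omega) a (fiberGysin hf t q b) = 0) →
            fiberGysin hf t q b = 0 := by
  rw [cmFibreAlgebraicLift_iff_comap_le_sup]
  refine ⟨fun h d 𝒳 S f hf t ht p q hpq ↦ numericalInv_of_comap_le_sup hf t hpq (h f hf p t ht),
    fun h d 𝒳 S f hf p t ht ↦ ?_⟩
  rcases le_or_gt p d with hp | hp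
  · exact comap_le_sup_of_numericalInv hf t (show p + (d - p) = d by omega) (h f hf t ht p (d - p) (by omega))
  · haveI := subsingleton_complexBetti (hf.isSmoothProjective_fiberOver t) (show 2 * d < 2 * p by omega)
    intro W _
    refine Submodule.mem_sup_right ?_
    rw [LinearMap.mem_ker]
    exact Subsingleton.elim _ _

end Summit.HodgeConjecture.HodgeConjecture.Ring2.AbelianAll

end
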